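import Summits.HodgeConjecture.HodgeConjecture.Theorems.MarkmanPartnerTransportPicardThreeK3SquaresOneCycleHodge
import Summits.HodgeConjecture.HodgeConjecture.Theorems.NikulinTwinTransportTwinTransportRMPicardTwoStubPushPullSpec
import Literature.AlgebraicGeometry.HodgeTheory.ComplexOrientationCycleClassFacts
import Literature.AlgebraicGeometry.HodgeTheory.CorrespondenceCupProductIdentities

/-!
# Route MarkmanPartnerTransport · crux `PicardThreeK3Squares` (stmt-HodgeConjecture-19652) —
# ONE CYCLE SUFFICES, part 4: a push–pull correspondence `f₊ g^*` through a surface acting on the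
# `2`-form by an irrational number (the van Geemen–Schütt mechanism, abstractly)

Conclusion of the line «one cycle suffices» (prover 19652-p1 g8; parts 1–3: `…OneCycleAlgebra`,
`…OneCycle`, `…OneCycleHodge`) in the shape of EVERY printed source of real multiplication induced
by a cycle: van Geemen–Schütt 2025 §4.8 (the cycle `Γ₁ + Γ₋₁` on `𝓔̃_a × 𝓔̃_a`, graphs of the
automorphism `σ^{±1}` of the base-changed surface `𝓔̃_a` DOMINATING the K3 surface, pushed down) and
§6.4 (the graph of a rational self-map `φ' ∘ ψ` of degree `2` acting on `ω` by `√2` — a push–pull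
through the resolution of its graph). The tree's `exists_algebraic_corrAction_eq_of_pushPull` (Fulton
§16.1: the graph class `(f, g)₊ 1 ∈ N²H⁴(S × S)` acts by `f₊ g^*`) makes any push–pull operator
`f₊ ∘ g^*` through a smooth projective surface `Y` (`f g : Y ⟶ S`) a cycle-induced endomorphism of
`H²(S(ℂ); ℂ)`; for the complex orientations it preserves rational classes
(`isRationalClass_complexGysin_complexOrientationFamily`, `IsRationalClass.map`) and Hodge types
(`isOfHodgeType_complexGysin_map`). Hence, by `hodgeConjectureFor_square_of_oneCycle_of_picard`:

* `hodgeConjectureFor_square_of_pushPull` — **a projective K3 surface `S` with `ρ(S) ∉ {2, 4, 6, 10}`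
  admitting a smooth projective surface `Y` and morphisms `f g : Y ⟶ S` such that `f₊ g^*` acts on a
  non-zero `(2,0)`-class by a NON-RATIONAL scalar satisfies `HodgeConjectureFor 4 (S ⊗ S)`** (mod
  Buskin's Thm. 1.1 for the CM branch, and markings);
* `hodgeConjectureFor_square_of_dominating_endomorphism` — the case `f = π`, `g = σ ≫ π` for a
  morphism `π : Y ⟶ S` and an endomorphism `σ : Y ⟶ Y`: `π₊ σ^* π^*` (van Geemen–Schütt §4.8 with one
  graph; for `Γ₁ + Γ₋₁` use `hodgeConjectureFor_square_of_pushPull_add`);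
* `hodgeConjectureFor_square_of_pushPull_add` — the two-term operator `f₊ g^* + f₊ g'^*`
  (`exists_algebraic_corrAction_eq_pushPull_add`), the literal shape of `Γ₁ + Γ₋₁`.

So the RM residue of the crux at `ρ(S) ∈ {7, 8, 12, 13, 14, 16}` (and the free ranks) reads: find a
surface `Y → S × S` whose push–pull moves `ω_S` off `ℚ ω_S`. No named fact beyond Buskin (CM branch
only) and markings; no definition, no sorry. Prover seat hodge-nonav-19652-p1 (gen 8),
`--supports stmt-HodgeConjecture-19652`. Nothing here proves the crux or the Hodge conjecture.

References: van Geemen–Schütt, Forum Math. Sigma 13 (2025) e2, Prop. 4.6, §4.8, Rem. 4.9, §6.4;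
Fulton, *Intersection Theory*, §16.1 Prop. 16.1.1, Def. 16.1.2; Voisin, *Hodge Theory and Complex
Algebraic Geometry I*, §7.3.2, §11.1.2; Buskin, J. reine angew. Math. 755 (2019), Thm. 1.1.
-/

set_option linter.dupNamespace false

noncomputable section

namespace Summit.HodgeConjecture.HodgeConjecture.Theorems.MarkmanPartnerTransport.OneCycle

open scoped Manifold TensorProduct
open Module CategoryTheory MonoidalCategory CartesianMonoidalCategory
open Literature.AlgebraicGeometry Literature.AlgebraicGeometry.Motives Literature.AlgebraicGeometry.HodgeTheory
open Literature.AlgebraicGeometry.Surfaces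
open Literature.AlgebraicTopology.SingularHomology
open Summit.HodgeConjecture.HodgeConjecture.Theorems
open Summit.HodgeConjecture.HodgeConjecture.Theorems.NikulinTwinTransport

variable {S Y : SchemeOver ℂ}

/-- **HC⁴(S ⊗ S) from ONE push–pull correspondence acting irrationally on the `2`-form.** Let `S` be a
projective K3 surface with `ρ(S) ∉ {2, 4, 6, 10}`, `Y` a smooth projective surface and `f g : Y ⟶ S`.
If the operator `f₊ ∘ g^*` on `H²(S(ℂ); ℂ)` (Gysin morphism of the complex orientations, pull-back)
has a non-rational eigenvalue on a non-zero `(2,0)`-class, then `HodgeConjectureFor 4 (S ⊗ S)`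
(granted Buskin's Thm. 1.1 for the CM branch, and markings): `f₊ g^*` is the action of the algebraic
graph class `(f, g)₊ 1` (`exists_algebraic_corrAction_eq_of_pushPull`), preserves rational classes and
Hodge types, and `hodgeConjectureFor_square_of_oneCycle_of_picard` applies.
[cite: GeemenSchutt2023, §4.8, Rem. 4.9 and §6.4] [cite: Fulton1998, §16.1 Prop. 16.1.1 and Def. 16.1.2]
[cite: VoisinHodgeI2002, §7.3.2] [cite: Buskin2019, Thm. 1.1] -/
theorem hodgeConjectureFor_square_of_pushPull (hB : Buskin2019_hodgeIsometry_algebraic)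
    (hmark : Huybrechts_K3_marking_exists) (hS : IsK3Surface S)
    (h2 : Module.finrank ℂ ↥(algebraicClasses S 1) ≠ 2) (h4 : Module.finrank ℂ ↥(algebraicClasses S 1) ≠ 4)
    (h6 : Module.finrank ℂ ↥(algebraicClasses S 1) ≠ 6) (h10 : Module.finrank ℂ ↥(algebraicClasses S 1) ≠ 10)
    (hY : IsSmoothProjective 2 Y) (f g : Y ⟶ S)
    (hev : ∃ (σ₀ : complexBetti S (2 * 1)) (ev : ℂ), IsOfHodgeType 2 S (2 * 1) 2 0 σ₀ ∧ σ₀ ≠ 0 ∧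
      complexGysin complexOrientationFamily hY hS.isSmoothProjective f (rfl : 2 * 1 + 2 * 2 = 2 * 1 + 2 * 2)
        (complexBetti.map g (2 * 1) σ₀) = ev • σ₀ ∧ ∀ a : ℚ, (a : ℂ) ≠ ev) :
    HodgeConjectureFor 4 (S ⊗ S) := by
  have hSsp := hS.isSmoothProjective
  set e : complexBetti S (2 * 1) →ₗ[ℂ] complexBetti S (2 * 1) :=
    complexGysin complexOrientationFamily hY hSsp f (rfl : 2 * 1 + 2 * 2 = 2 * 1 + 2 * 2) ∘ₗ
      (complexBetti.map g (2 * 1)).hom with he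
  have he_app : ∀ y, e y = complexGysin complexOrientationFamily hY hSsp f
      (rfl : 2 * 1 + 2 * 2 = 2 * 1 + 2 * 2) (complexBetti.map g (2 * 1) y) := fun _ ↦ rfl
  -- `e = f₊ g^*` is the action of the algebraic graph class `(f, g)₊ 1`
  obtain ⟨γ, hγ, hγe⟩ := exists_algebraic_corrAction_eq_of_pushPull (μ := complexOrientationFamily)
    complexOrientationFamily.hasPoincareDuality hSsp (a := 2 * 1) (T := e)
    ⟨Y, hY, f, g, 1, by rw [one_smul]⟩
  have he_cyc : ∃ γ ∈ algebraicClasses (S ⊗ S) 2, ∀ y : complexBetti S (2 * 1),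
      e y = complexGysin complexOrientationFamily (IsSmoothProjective.tensor_holds hSsp hSsp) hSsp
        (SemiCartesianMonoidalCategory.fst _ _) (rfl : 2 * 1 + 2 * 2 + 2 * 2 = 2 * 1 + 2 * (2 + 2))
        (cupProduct (rfl : 2 * 1 + 2 * 2 = 2 * 1 + 2 * 2)
          (complexBetti.map (SemiCartesianMonoidalCategory.snd _ _) (2 * 1) y) γ) :=
    ⟨γ, hγ, fun y ↦ by rw [← hγe]; rfl⟩
  -- `e` preserves rational classes and Hodge types
  have he_rat : ∀ y, IsRationalClass y → IsRationalClass (e y) := fun y hy ↦ by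
    rw [he_app]
    exact isRationalClass_complexGysin_complexOrientationFamily hY hSsp f rfl
      (hy.map (AlgPoints.mapContinuous (L := ℂ) g))
  have he_typ : ∀ (i j : ℕ) y, IsOfHodgeType 2 S (2 * 1) i j y →
      IsOfHodgeType 2 S (2 * 1) i j (e y) := fun i j y hy ↦ by
    rw [he_app]
    exact isOfHodgeType_complexGysin_map complexOrientationFamily hSsp hY f g rfl rfl rfl hy
  obtain ⟨σ₀, ev, h20, hne, heq, hirr⟩ := hev
  exact hodgeConjectureFor_square_of_oneCycle_of_picard hB hmark hS h2 h4 h6 h10 complexOrientationFamily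
    e he_rat he_typ he_cyc ⟨σ₀, ev, h20, hne, by rw [he_app]; exact heq, hirr⟩

/-- **The van Geemen–Schütt mechanism, abstractly: an endomorphism of a surface mapping to `S`.** Let
`S` be a projective K3 surface with `ρ(S) ∉ {2, 4, 6, 10}`, `π : Y ⟶ S` a morphism from a smooth
projective surface and `σ : Y ⟶ Y` an endomorphism (in loc. cit. §4.8: the automorphism `σ` of order
`n` of the base change `𝓔̃_a` of the elliptic K3 surface `𝓔_a`, `π` the quotient by `τ`). If
`π₊ σ^* π^*` acts on a non-zero `(2,0)`-class of `S` by a non-rational scalar, then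
`HodgeConjectureFor 4 (S ⊗ S)` (mod Buskin's Thm. 1.1 for the CM branch, and markings) — the case
`f = π`, `g = σ ≫ π` of `hodgeConjectureFor_square_of_pushPull`.
[cite: GeemenSchutt2023, Prop. 4.6, §4.8 and Rem. 4.9] [cite: Fulton1998, §16.1 Prop. 16.1.1]
[cite: Buskin2019, Thm. 1.1] -/
theorem hodgeConjectureFor_square_of_dominating_endomorphism (hB : Buskin2019_hodgeIsometry_algebraic)
    (hmark : Huybrechts_K3_marking_exists) (hS : IsK3Surface S)
    (h2 : Module.finrank ℂ ↥(algebraicClasses S 1) ≠ 2) (h4 : Module.finrank ℂ ↥(algebraicClasses S 1) ≠ 4)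
    (h6 : Module.finrank ℂ ↥(algebraicClasses S 1) ≠ 6) (h10 : Module.finrank ℂ ↥(algebraicClasses S 1) ≠ 10)
    (hY : IsSmoothProjective 2 Y) (π : Y ⟶ S) (σ : Y ⟶ Y)
    (hev : ∃ (σ₀ : complexBetti S (2 * 1)) (ev : ℂ), IsOfHodgeType 2 S (2 * 1) 2 0 σ₀ ∧ σ₀ ≠ 0 ∧
      complexGysin complexOrientationFamily hY hS.isSmoothProjective π (rfl : 2 * 1 + 2 * 2 = 2 * 1 + 2 * 2)
        (complexBetti.map σ (2 * 1) (complexBetti.map π (2 * 1) σ₀)) = ev • σ₀ ∧ ∀ a : ℚ, (a : ℂ) ≠ ev) :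
    HodgeConjectureFor 4 (S ⊗ S) := by
  refine hodgeConjectureFor_square_of_pushPull hB hmark hS h2 h4 h6 h10 hY π (σ ≫ π) ?_
  obtain ⟨σ₀, ev, h20, hne, heq, hirr⟩ := hev
  refine ⟨σ₀, ev, h20, hne, ?_, hirr⟩
  rw [complexBetti.map_comp_apply']
  exact heq

/-- **Two-term push–pull `f₊ g^* + f₊ g'^*`** (the literal shape of van Geemen–Schütt's `Γ₁ + Γ₋₁`:
`f = π`, `g = σ ≫ π`, `g' = σ⁻¹ ≫ π`): for a projective K3 surface `S` with `ρ(S) ∉ {2, 4, 6, 10}`, a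
smooth projective surface `Y` and `f g g' : Y ⟶ S`, if `f₊ g^* + f₊ g'^*` acts on a non-zero
`(2,0)`-class by a non-rational scalar then `HodgeConjectureFor 4 (S ⊗ S)` (mod Buskin, markings):
the operator is the action of the algebraic class `(f, g)₊ 1 + (f, g')₊ 1`
(`exists_algebraic_corrAction_eq_pushPull_add`). [cite: GeemenSchutt2023, §4.8 and Rem. 4.9]
[cite: Fulton1998, §16.1 Prop. 16.1.1 and Def. 16.1.2] [cite: Buskin2019, Thm. 1.1] -/
theorem hodgeConjectureFor_square_of_pushPull_add (hB : Buskin2019_hodgeIsometry_algebraic)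
    (hmark : Huybrechts_K3_marking_exists) (hS : IsK3Surface S)
    (h2 : Module.finrank ℂ ↥(algebraicClasses S 1) ≠ 2) (h4 : Module.finrank ℂ ↥(algebraicClasses S 1) ≠ 4)
    (h6 : Module.finrank ℂ ↥(algebraicClasses S 1) ≠ 6) (h10 : Module.finrank ℂ ↥(algebraicClasses S 1) ≠ 10)
    (hY : IsSmoothProjective 2 Y) (f g g' : Y ⟶ S)
    (hev : ∃ (σ₀ : complexBetti S (2 * 1)) (ev : ℂ), IsOfHodgeType 2 S (2 * 1) 2 0 σ₀ ∧ σ₀ ≠ 0 ∧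
      complexGysin complexOrientationFamily hY hS.isSmoothProjective f (rfl : 2 * 1 + 2 * 2 = 2 * 1 + 2 * 2)
          (complexBetti.map g (2 * 1) σ₀) +
        complexGysin complexOrientationFamily hY hS.isSmoothProjective f (rfl : 2 * 1 + 2 * 2 = 2 * 1 + 2 * 2)
          (complexBetti.map g' (2 * 1) σ₀) = ev • σ₀ ∧ ∀ a : ℚ, (a : ℂ) ≠ ev) :
    HodgeConjectureFor 4 (S ⊗ S) := by
  have hSsp := hS.isSmoothProjective
  set e : complexBetti S (2 * 1) →ₗ[ℂ] complexBetti S (2 * 1) :=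
    (1 : ℂ) • (complexGysin complexOrientationFamily hY hSsp f (rfl : 2 * 1 + 2 * 2 = 2 * 1 + 2 * 2) ∘ₗ
      (complexBetti.map g (2 * 1)).hom) +
    (1 : ℂ) • (complexGysin complexOrientationFamily hY hSsp f (rfl : 2 * 1 + 2 * 2 = 2 * 1 + 2 * 2) ∘ₗ
      (complexBetti.map g' (2 * 1)).hom) with he
  have he_app : ∀ y, e y = complexGysin complexOrientationFamily hY hSsp f
      (rfl : 2 * 1 + 2 * 2 = 2 * 1 + 2 * 2) (complexBetti.map g (2 * 1) y) +
      complexGysin complexOrientationFamily hY hSsp f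
      (rfl : 2 * 1 + 2 * 2 = 2 * 1 + 2 * 2) (complexBetti.map g' (2 * 1) y) := fun y ↦ by
    simp only [he, LinearMap.add_apply, one_smul]
    rfl
  obtain ⟨γ, hγ, hγe⟩ := exists_algebraic_corrAction_eq_pushPull_add (μ := complexOrientationFamily)
    complexOrientationFamily.hasPoincareDuality hSsp hY f g g' 1 (a := 2 * 1)
  have he_cyc : ∃ γ ∈ algebraicClasses (S ⊗ S) 2, ∀ y : complexBetti S (2 * 1),
      e y = complexGysin complexOrientationFamily (IsSmoothProjective.tensor_holds hSsp hSsp) hSsp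
        (SemiCartesianMonoidalCategory.fst _ _) (rfl : 2 * 1 + 2 * 2 + 2 * 2 = 2 * 1 + 2 * (2 + 2))
        (cupProduct (rfl : 2 * 1 + 2 * 2 = 2 * 1 + 2 * 2)
          (complexBetti.map (SemiCartesianMonoidalCategory.snd _ _) (2 * 1) y) γ) :=
    ⟨γ, hγ, fun y ↦ by rw [he, ← hγe]; rfl⟩
  have he_rat : ∀ y, IsRationalClass y → IsRationalClass (e y) := fun y hy ↦ by
    rw [he_app]
    exact (isRationalClass_complexGysin_complexOrientationFamily hY hSsp f rfl
      (hy.map (AlgPoints.mapContinuous (L := ℂ) g))).add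
      (isRationalClass_complexGysin_complexOrientationFamily hY hSsp f rfl
        (hy.map (AlgPoints.mapContinuous (L := ℂ) g')))
  have he_typ : ∀ (i j : ℕ) y, IsOfHodgeType 2 S (2 * 1) i j y →
      IsOfHodgeType 2 S (2 * 1) i j (e y) := fun i j y hy ↦ by
    rw [he_app]
    exact (isOfHodgeType_complexGysin_map complexOrientationFamily hSsp hY f g rfl rfl rfl hy).add hSsp
      (isOfHodgeType_complexGysin_map complexOrientationFamily hSsp hY f g' rfl rfl rfl hy)
  obtain ⟨σ₀, ev, h20, hne, heq, hirr⟩ := hev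
  exact hodgeConjectureFor_square_of_oneCycle_of_picard hB hmark hS h2 h4 h6 h10 complexOrientationFamily
    e he_rat he_typ he_cyc ⟨σ₀, ev, h20, hne, by rw [he_app]; exact heq, hirr⟩

end Summit.HodgeConjecture.HodgeConjecture.Theorems.MarkmanPartnerTransport.OneCycle

end
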